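import Summits.CriticalPhenomena.CardyFormulaZ2.Theorems.CardyMagicRigidityMarkovCascadeDefs
import Summits.CriticalPhenomena.CardyFormulaZ2.Theorems.CardyMagicRigidityNestingRigidityOneGenerationTInterior
import Literature.Probability.Percolation.SiteInterfaceSeparation
import Literature.Probability.Percolation.SiteInterfaceWindingSigns
import Literature.Probability.Percolation.CLE6Proofs
import HarnessLib

/-!
# The outermost loops of the closed-b.c. site-`𝕋` domain ensemble are all of type `1`

Crux `Summit.CriticalPhenomena.CardyFormulaZ2.Theses.CardyMagicRigidity.NestingRigidity`
(stmt-CriticalPhenomena-4835), line `markov-cascade-one-generation`, registered helper (wave 2)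
`firstGen_domLoopsT_F_zero` toward the stubs `stub_kernelUniqueness` / `stub_cascadeReconstruction`
(vocabulary `Theorems/CardyMagicRigidityMarkovCascadeDefs.lean`: `firstGen`, `domLoopsT`).

**Statement.** For `δ > 0` and bounded `U`, no loop of type `0` of
`domLoopsT U δ ω = siteLoopConfig δ (ω ∩ triMeshVertices U δ)` is outermost:
`(firstGen (domLoopsT U δ ω)).F 0 = ∅`.

**Proof** (a lattice theorem about a configuration `ω'` with finitely many open sites, here
`ω' = ω ∩ triMeshVertices U δ`, `triMeshVertices_finite_holds`).  Let `γ` be an interface loop of `ω'` of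
type `0` (non-positive shoelace sum: clockwise, `SiteInterfaceWindingSigns.lean`): its polygon winds `0`
times about its left (open) site `x₀ = lv 0` and `-1` times about its right (closed) site `y₀ = rv 0`.
The open cluster `C` of `x₀` is finite, and a site `v₀` far out on the lattice ray is closed and
outside every interface polygon of `ω'` (all traces lie within `δ` of the open sites,
`polyTrace_subset_cthickening_image`).  The separation theorem
`exists_isSiteInterfaceLoop_loopWind_eq` (`SiteInterfaceSeparation.lean`) yields an interface loop `w` of
`ω'` winding `m` times about the sites of `C` and `m - 1 = 0` times about `v₀`: so `W_w(x₀) = 1`.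
The edge `x₀ y₀` is not crossed by `w` (a loop of `ω'` crossing it shares a face with `γ`, hence has the
same trace and the same winding interior, `interior_eq_of_lv_eq_rv_eq` — Jordan, through
`inside_hexJordanLoop_eq` of `…OneGenerationTInterior` — but `x₀` is inside `w` and outside `γ`), so
`W_w(y₀) = W_w(x₀) = 1` as well.  In the trichotomy `interior_trichotomy` (interiors of two interface
loops of one configuration are nested or disjoint) the point `y₀` (inside both) excludes disjointness and
`x₀` (inside `w`, outside `γ`) excludes `int w ⊆ int γ`: hence `int γ ⊊ int w`, and `[w]` is a loop of
`domLoopsT U δ ω`, so `[γ] ∉ firstGen`.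
-/

noncomputable section

open Set Metric Filter
open scoped Topology Real

namespace Summit.CriticalPhenomena.CardyFormulaZ2.Cruxes.NestingRigidity.MarkovCascadeOneGeneration

open Literature.Probability.RandomPlanarGeometry Literature.Probability.Percolation
  Literature.Probability.LatticeModels Literature.Topology.PlaneTopology

/-! ## §1 Same trace, same winding interior -/

section Trace

variable {f₀ f₁ : HexVertex}

/-- The Jordan parametrisation of the polygon of a closed walk of `H` (the local notation of
`…OneGenerationTInterior`, unfolded identically). -/
local notation3 "JL⟦" δ ", " w "⟧" =>
  (fun t : ℝ ↦ IccExtend zero_le_one (⇑(hexLoopCurve δ w)) (tailStart (SimpleGraph.Walk.length w) * Int.fract t))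

/-- The trace of the Jordan parametrisation of a walk with a dart is the lattice trace `polyTrace`. -/
theorem range_hexJordanLoop_eq_polyTrace (δ : ℝ) {w : hexGraph.Walk f₀ f₀} (hlen : 0 < w.length) :
    range (JL⟦δ, w⟧) = polyTrace δ w := by
  rw [range_hexJordanLoop δ hlen, Curve.range]
  exact range_toCurve_eq_polyTrace hlen

/-- **Two cycles of `H` with the same trace at mesh `δ ≠ 0` have the same winding interior**: the
interior is the inside of the Jordan curve (`inside_hexJordanLoop_eq`), a function of the trace alone. -/
theorem interior_eq_of_polyTrace_eq {δ : ℝ} (hδ : δ ≠ 0) {w : hexGraph.Walk f₀ f₀} {w' : hexGraph.Walk f₁ f₁}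
    (hw : w.IsCycle) (hw' : w'.IsCycle) (h : polyTrace δ w = polyTrace δ w') :
    {z | (siteLoopCurve δ w).wind z ≠ 0} = {z | (siteLoopCurve δ w').wind z ≠ 0} := by
  have hlen : 0 < w.length := by have := hw.three_le_length; omega
  have hlen' : 0 < w'.length := by have := hw'.three_le_length; omega
  have hr : range (JL⟦δ, w⟧) = polyTrace δ w := range_hexJordanLoop_eq_polyTrace δ hlen
  have hr' : range (JL⟦δ, w'⟧) = polyTrace δ w' := range_hexJordanLoop_eq_polyTrace δ hlen'
  rw [← inside_hexJordanLoop_eq hδ hw, ← inside_hexJordanLoop_eq hδ hw']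
  simp only [IsJordanLoop.inside, hr, hr', h]

end Trace

/-! ## §2 A clockwise interface loop of a finite configuration is strictly inside another loop -/

section Finite

variable {ω : SiteConfig (Site 2)} {f₀ f₁ : HexVertex} {γ : hexGraph.Walk f₀ f₀} {w : hexGraph.Walk f₁ f₁}

/-- **Two interface loops of one configuration crossing the same `𝕋`-dart have the same winding
interior**: the crossed dart determines the hexagonal dart (`dart_spec`), so the loops share a face,
hence the trace (`polyTrace_eq_of_mem_support`), hence the interior (`interior_eq_of_polyTrace_eq`). -/
theorem interior_eq_of_lv_eq_rv_eq (hγ : IsSiteInterfaceLoop ω γ) (hw : IsSiteInterfaceLoop ω w)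
    {i j : ℕ} (hi : i < γ.length) (hj : j < w.length) (hl : hγ.lv i = hw.lv j) (hr : hγ.rv i = hw.rv j)
    {δ : ℝ} (hδ : δ ≠ 0) :
    {z | (siteLoopCurve δ γ).wind z ≠ 0} = {z | (siteLoopCurve δ w).wind z ≠ 0} := by
  obtain ⟨h, hfaces, -, -⟩ := hγ.dart_spec hi
  obtain ⟨h', hfaces', -, -⟩ := hw.dart_spec hj
  have hd : (⟨(hγ.lv i, hγ.rv i), h⟩ : triGraph.Dart) = ⟨(hw.lv j, hw.rv j), h'⟩ :=
    SimpleGraph.Dart.ext _ _ (Prod.ext hl hr)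
  rw [hd, hfaces'] at hfaces
  have hv : w.getVert j = γ.getVert i := congrArg Prod.snd hfaces
  refine interior_eq_of_polyTrace_eq hδ hγ.isCycle hw.isCycle ?_
  exact hγ.polyTrace_eq_of_mem_support hw (γ.getVert_mem_support i)
    (by rw [← hv]; exact w.getVert_mem_support j) δ

/-- **The trace of an interface polygon lies within `δ` of the open sites** (`δ ≥ 0`): every dart has
an open site on its left, within `δ` of both ends of its piece
(`segment_subset_cthickening_of_isSiteInterfaceLoop`). -/
theorem polyTrace_subset_cthickening_image (hw : IsSiteInterfaceLoop ω w) {δ : ℝ} (hδ : 0 ≤ δ) :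
    polyTrace δ w ⊆ cthickening δ (triMeshPoint δ '' ω) := by
  have hlen : 0 < w.length := by have := hw.isCycle.three_le_length; omega
  rw [← range_toCurve_eq_polyTrace hlen]
  have hsub : ω ⊆ triMeshVertices (triMeshPoint δ '' ω) δ := fun x hx ↦
    mem_image_of_mem (triMeshPoint δ) hx
  have hw' : IsSiteInterfaceLoop (ω ∩ triMeshVertices (triMeshPoint δ '' ω) δ) w := by
    rwa [inter_eq_left.2 hsub]
  exact SimpleGraph.Walk.range_toCurve_subset_of_not_nil hw.isCycle.not_nil
    fun d hd ↦ segment_subset_cthickening_of_isSiteInterfaceLoop hδ hw' hd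

/-- **A clockwise interface loop of a configuration with finitely many open sites is strictly enclosed
by another interface loop of the same configuration** (at every mesh `δ > 0`): the outer boundary of
the open cluster of its left site.  See the module docstring for the proof. -/
theorem exists_interior_ssubset_of_shoelace_nonpos (hfin : ω.Finite) (hγ : IsSiteInterfaceLoop ω γ)
    (hsh : shoelace (γ.support.map hexCenter) ≤ 0) {δ : ℝ} (hδ : 0 < δ) :
    ∃ (f₁ : HexVertex) (w : hexGraph.Walk f₁ f₁), IsSiteInterfaceLoop ω w ∧
      {z | (siteLoopCurve δ γ).wind z ≠ 0} ⊂ {z | (siteLoopCurve δ w).wind z ≠ 0} := by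
  have hlen : 0 < γ.length := by have := hγ.isCycle.three_le_length; omega
  -- a disc containing every interface polygon of `ω`, and a closed site `v₀` beyond it
  obtain ⟨ρ, hρ⟩ := ((hfin.image (triMeshPoint δ)).isBounded.cthickening (δ := δ)).subset_closedBall (0 : ℂ)
  obtain ⟨N, hN⟩ : ∃ N : ℕ, ρ < δ * N :=
    ⟨⌈|ρ| / δ⌉₊ + 1, by
      have h1 : |ρ| ≤ (⌈|ρ| / δ⌉₊ : ℝ) * δ := (div_le_iff₀ hδ).1 (Nat.le_ceil _)
      push_cast
      nlinarith [le_abs_self ρ]⟩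
  set v₀ : Site 2 := Pi.single 0 (N : ℤ) with hv₀_def
  have hnorm : ρ < dist (triMeshPoint δ v₀) 0 := by
    rw [dist_zero_right, triMeshPoint, hv₀_def, triEmbed_single_zero_natCast, norm_mul,
      Complex.norm_real, Complex.norm_natCast, Real.norm_eq_abs, abs_of_pos hδ]
    exact hN
  have hv₀ : v₀ ∉ ω := fun h ↦ by
    have h' := hρ (self_subset_cthickening _ (mem_image_of_mem (triMeshPoint δ) h))
    rw [mem_closedBall] at h'
    exact absurd h' (not_le.2 hnorm)
  -- the left and right sites of the first step of `γ`
  set x₀ : Site 2 := hγ.lv 0 with hx₀_def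
  set y₀ : Site 2 := hγ.rv 0 with hy₀_def
  have hx₀ : x₀ ∈ ω := hγ.lv_mem hlen
  have hγx₀ : loopWind δ γ (triMeshPoint δ x₀) = 0 :=
    hγ.loopWind_leftPt_eq_zero_of_shoelace_nonpos hδ hsh hlen
  have hγy₀ : loopWind δ γ (triMeshPoint δ y₀) = -1 :=
    hγ.loopWind_rightPt_eq_neg_one_of_shoelace_nonpos hδ hsh hlen
  -- the separating loop of the (finite) open cluster of `x₀` from `v₀`
  have hfinC : {x | PathIn triGraph ω x₀ x}.Finite := hfin.subset fun x hx ↦ hx.right_mem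
  obtain ⟨F, w, hw, -, -, hfar⟩ := exists_isSiteInterfaceLoop_loopWind_eq hδ hfinC hx₀ hv₀
  have hlenw : 0 < w.length := by have := hw.isCycle.three_le_length; omega
  have hwv₀ : loopWind δ w (triMeshPoint δ v₀) = 0 :=
    loopWind_eq_zero_of_lt_dist hlenw ((polyTrace_subset_cthickening_image hw hδ.le).trans hρ) hnorm
  have hwx₀ : loopWind δ w (triMeshPoint δ x₀) = 1 := by
    have h := hfar v₀ (PathIn.refl hv₀)
    omega
  -- interiors at the two sites
  have hx₀w : triMeshPoint δ x₀ ∈ {z | (siteLoopCurve δ w).wind z ≠ 0} := by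
    rw [mem_setOf_eq, wind_siteLoopCurve_eq_loopWind hlenw (hw.triMeshPoint_not_mem_polyTrace hδ _), hwx₀]
    exact one_ne_zero
  have hx₀γ : triMeshPoint δ x₀ ∉ {z | (siteLoopCurve δ γ).wind z ≠ 0} := by
    rw [mem_setOf_eq, wind_siteLoopCurve_eq_loopWind hlen (hγ.triMeshPoint_not_mem_polyTrace hδ _), hγx₀]
    exact fun h ↦ h rfl
  -- the edge `x₀ y₀` is not crossed by `w`, so `W_w(y₀) = W_w(x₀) = 1`
  have hwy₀ : loopWind δ w (triMeshPoint δ y₀) = 1 := by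
    rw [← hwx₀]
    refine (hw.loopWind_triMeshPoint_eq_of_adj hδ (Or.inr (hγ.adj_lv_rv hlen)) fun j hj ↦
      ⟨fun hh ↦ ?_, fun hh ↦ hw.rv_not_mem hj (hh.1 ▸ hx₀)⟩).symm
    have heq := interior_eq_of_lv_eq_rv_eq hγ hw hlen hj hh.1 hh.2 hδ.ne'
    rw [← heq] at hx₀w
    exact hx₀γ hx₀w
  have hy₀w : triMeshPoint δ y₀ ∈ {z | (siteLoopCurve δ w).wind z ≠ 0} := by
    rw [mem_setOf_eq, wind_siteLoopCurve_eq_loopWind hlenw (hw.triMeshPoint_not_mem_polyTrace hδ _), hwy₀]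
    exact one_ne_zero
  have hy₀γ : triMeshPoint δ y₀ ∈ {z | (siteLoopCurve δ γ).wind z ≠ 0} := by
    rw [mem_setOf_eq, wind_siteLoopCurve_eq_loopWind hlen (hγ.triMeshPoint_not_mem_polyTrace hδ _), hγy₀]
    exact fun h ↦ by omega
  -- conclude by the trichotomy
  refine ⟨F, w, hw, ?_⟩
  rcases interior_trichotomy hγ hw hδ with h | h | h
  · exact absurd (h hx₀w) hx₀γ
  · rw [ssubset_def]
    exact ⟨h, fun h' ↦ hx₀γ (h' hx₀w)⟩
  · exact absurd hy₀w (disjoint_left.1 h hy₀γ)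

end Finite

/-! ## §3 The registered helper -/

/-- **The outermost loops of the closed-b.c. site-`𝕋` domain ensemble are all of type `1`**
(registered helper, wave 2, toward `stub_kernelUniqueness` / `stub_cascadeReconstruction`): for
`δ > 0` and bounded `U`, `(firstGen (domLoopsT U δ ω)).F 0 = ∅` — every clockwise interface loop of the
finite configuration `ω ∩ triMeshVertices U δ` is strictly enclosed by another interface loop of it
(`exists_interior_ssubset_of_shoelace_nonpos`), which is a loop of `domLoopsT U δ ω`. -/
theorem firstGen_domLoopsT_F_zero : ∀ (U : Set ℂ) (δ : ℝ) (ω : SiteConfig (Site 2)), 0 < δ → Bornology.IsBounded U → (firstGen (domLoopsT U δ ω)).F 0 = ∅ := by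
  intro U δ ω hδ hU
  rw [eq_empty_iff_forall_notMem]
  rintro u ⟨hu, hmax⟩
  change u ∈ (siteLoopConfig δ (ω ∩ triMeshVertices U δ)).F 0 at hu
  obtain ⟨v, γ, hγ, htype, rfl⟩ := mem_siteLoopConfig_iff.1 hu
  have hsh : shoelace (γ.support.map hexCenter) ≤ 0 :=
    not_lt.1 fun h ↦ absurd (htype.2 h) (by decide)
  have hfin : (ω ∩ triMeshVertices U δ).Finite :=
    (triMeshVertices_finite_holds hU hδ).subset inter_subset_right
  obtain ⟨F, w, hw, hss⟩ := exists_interior_ssubset_of_shoelace_nonpos hfin hγ hsh hδ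
  have hwl : UnbasedLoop.mk (BasedLoop.mk (siteLoopCurve δ w) (isLoop_siteLoopCurve δ w)) ∈
      (domLoopsT U δ ω).loops := by
    rcases lt_or_ge 0 (shoelace (w.support.map hexCenter)) with hpos | hnp
    · exact Or.inr ⟨F, w, hw, ⟨fun _ ↦ hpos, fun _ ↦ rfl⟩, rfl⟩
    · exact Or.inl ⟨F, w, hw, ⟨fun h ↦ absurd h (by decide), fun h ↦ absurd h (not_lt.2 hnp)⟩, rfl⟩
  exact hmax _ hwl hss

end Summit.CriticalPhenomena.CardyFormulaZ2.Cruxes.NestingRigidity.MarkovCascadeOneGeneration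

end
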